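import Summits.KontsevichZagierPeriods.KontsevichZagierPeriods.Theorems.LinRedNormalFormArrangementNormalFormStubRebaseSimpleZeroNestedDiffE2BlowMap

/-!
# Stub `stub_rebaseSimpleZeroTwo`, part `HPar1` (crux `ArrangementNormalForm`, line `janus-bands`)
— brick `NestedDiffE2Blow`

**The base blow-up move** of the E2 route (`RebaseDiff.good_blow`, registered as
`rebaseSimpleZero_e2Blow`). In the normalised frame (outer letter `κ` and top `τ` constant,
inner letter `cᵢ` of slope `λ`, simple base pole `r`, wall `ρ = cᵢ(r)`) let the clean nest
`A < tᵢ < tⱼ < τ` over `cell M` lie on one side of the pole (`εy (y − r) > 0`) and on one side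
of the wall (`εR (tᵢ − ρ) > 0`), in the cone `|tᵢ − ρ| ≤ C |y − r|`, and let its bottom `A` be
encoded in the blown-up coordinates by a player comparison `qA` (two encoders:
`RebaseDiff.blow_qA_const` for a constant bottom, `RebaseDiff.blow_qA_centre` for a bottom
through the centre `(r, ρ)`). Then the nest is good for `GG 0 2 2`: the chart
`y = r + (tᵢ − ρ)/b` (rule 2, `RebaseDiff.blowΨ`, `RebaseZero.cov_pull`) turns the literal
integrand `K/((y − r)(tᵢ − cᵢ(y))(tⱼ − κ))` into `εR K/((b − λ)(tᵢ − ρ)(tⱼ − κ))` — base `b`,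
simple pole `λ`, CONSTANT letters `ρ, κ` — over the bounded order-constrained polytope
`RebaseDiff.blowQ`, whose cells are good (`RebaseDiff.good_constraints`). No margin and no
convergence hypothesis is needed (rule 2 preserves absolute convergence): this is what closes the
pieces of the E2 dissection whose bounds are constant or pass through the centre (the piece
above the wall, the slab under the wall, the pinch at the pole).

References: M. Kontsevich, D. Zagier, *Periods* (2001), §1.2, rules (1a), (2).
-/

noncomputable section

open Set MeasureTheory MvPolynomial
open Literature.NumberTheory.Transcendental Literature.ModelTheory.ExponentialFields

namespace Summit.KontsevichZagierPeriods.ArrangementNormalForm.JanusBands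

namespace RebaseDiff

open SeparatePos RebasePos RebaseZero RebaseNest

variable {m' : ℕ} {i j : Fin 2}

/-! ### The blown-up polytope -/

/-- The player comparisons cutting out the blown-up polytope: the mutual bound, the top, a box
row, the sign rows `0 < εR (tᵢ − ρ)` and `0 < εb b`, the encoded bottom `qA`, and the rows of
the old base cell read through `y = r + (tᵢ − ρ)/b`. -/
def blowC (i j : Fin 2) (M : Fin m' → Cf) (qA : (Fin 2 ⊕ Cf) × (Fin 2 ⊕ Cf)) (β ρ r R₀ εR εb : ℚ) :
    Finset ((Fin 2 ⊕ Cf) × (Fin 2 ⊕ Cf)) :=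
  insert (Sum.inl i, Sum.inl j) (insert (Sum.inl j, Sum.inr (mk 0 β))
    (insert (Sum.inr (mk 0 (-R₀)), Sum.inl i)
      (insert (cmpLin i εR 0 (-(εR * ρ)))
        (insert (cmpLin i 0 εb 0)
          (insert qA
            (Finset.univ.image fun k => cmpLin i (εb * (M k).1 (Fin.last 0))
              (εb * ((M k).1 (Fin.last 0) * r + (M k).2)) (-(εb * (M k).1 (Fin.last 0) * ρ))))))))

/-- The blown-up polytope. -/
def blowQ (i j : Fin 2) (M : Fin m' → Cf) (qA : (Fin 2 ⊕ Cf) × (Fin 2 ⊕ Cf)) (β ρ r R₀ εR εb : ℚ) :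
    Set (Fin (0 + 1 + 2) → ℝ) :=
  {w | ∀ q ∈ blowC i j M qA β ρ r R₀ εR εb, pv q.1 w < pv q.2 w}

/-- **Membership in the blown-up polytope.** -/
theorem mem_blowQ (M : Fin m' → Cf) (qA : (Fin 2 ⊕ Cf) × (Fin 2 ⊕ Cf)) (β ρ r R₀ εR εb : ℚ)
    (w : Fin (0 + 1 + 2) → ℝ) :
    w ∈ blowQ i j M qA β ρ r R₀ εR εb ↔ tv w i < tv w j ∧ tv w j < β ∧ (-R₀ : ℝ) < tv w i ∧
      0 < (εR : ℝ) * (tv w i - ρ) ∧ 0 < (εb : ℝ) * yv w ∧ (pv qA.1 w < pv qA.2 w) ∧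
      ∀ k, 0 < (εb : ℝ) * ((((M k).1 (Fin.last 0) : ℝ) * r + (M k).2) * yv w +
        (M k).1 (Fin.last 0) * (tv w i - ρ)) := by
  simp only [blowQ, blowC, mem_setOf_eq, Finset.forall_mem_insert, Finset.forall_mem_image, Finset.mem_univ,
    true_imp_iff, cmpLin_iff, RebaseZero.pv_inl, RebaseZero.pv_inr, ev_mk]
  push_cast
  refine and_congr Iff.rfl (and_congr ?_ (and_congr ?_ (and_congr ?_ (and_congr ?_ (and_congr Iff.rfl
    (forall_congr' fun k => ?_))))))
  all_goals constructor <;> intro h <;> linarith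

/-- Every fibre is compared from both sides in `blowC`. -/
theorem blowC_hlu (hij : i ≠ j) (M : Fin m' → Cf) (qA : (Fin 2 ⊕ Cf) × (Fin 2 ⊕ Cf)) (β ρ r R₀ εR εb : ℚ) :
    ∀ v, (∃ q ∈ blowC i j M qA β ρ r R₀ εR εb, q.2 = Sum.inl v) ∧
      (∃ q ∈ blowC i j M qA β ρ r R₀ εR εb, q.1 = Sum.inl v) := by
  intro v
  rcases fin_two_eq_or hij v with rfl | rfl
  · exact ⟨⟨(Sum.inr (mk 0 (-R₀)), Sum.inl v), by simp [blowC], rfl⟩,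
      ⟨(Sum.inl v, Sum.inl j), by simp [blowC], rfl⟩⟩
  · exact ⟨⟨(Sum.inl i, Sum.inl v), by simp [blowC], rfl⟩,
      ⟨(Sum.inl v, Sum.inr (mk 0 β)), by simp [blowC], rfl⟩⟩

/-! ### Encoding the bottom -/

/-- **A constant bottom** is read verbatim in the blown-up coordinates. -/
theorem blow_qA_const (i : Fin 2) (A : Cf) (hA : A.1 (Fin.last 0) = 0) (ρ r εR εb : ℚ) :
    ∀ w : Fin (0 + 1 + 2) → ℝ, 0 < (εb : ℝ) * yv w → 0 < (εR : ℝ) * (tv w i - ρ) →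
      (pv (B := 0) (Sum.inr A : Fin 2 ⊕ Cf) w < pv (B := 0) (Sum.inl i : Fin 2 ⊕ Cf) w ↔
        ev A (r + (tv w i - ρ) / yv w) < tv w i) := fun w _ _ => by
  rw [RebaseZero.pv_inr, RebaseZero.pv_inl, ev, ev, hA, Rat.cast_zero, zero_mul, zero_mul]

/-- **A bottom through the centre `(r, ρ)`** (`A(r) = ρ`) becomes the pure base row
`0 < εy (b − A')` in the blown-up coordinates (`εy` the side of the pole, `εb = εR εy`). -/
theorem blow_qA_centre (i : Fin 2) (A : Cf) (ρ r εR εy : ℚ) (hεR : εR = 1 ∨ εR = -1) (hεy : εy = 1 ∨ εy = -1)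
    (hA : A.1 (Fin.last 0) * r + A.2 = ρ) :
    ∀ w : Fin (0 + 1 + 2) → ℝ, 0 < ((εR * εy : ℚ) : ℝ) * yv w → 0 < (εR : ℝ) * (tv w i - ρ) →
      (pv (cmpLin i 0 εy (-(εy * A.1 (Fin.last 0)))).1 w < pv (cmpLin i 0 εy (-(εy * A.1 (Fin.last 0)))).2 w ↔
        ev A (r + (tv w i - ρ) / yv w) < tv w i) := by
  intro w hb hR
  have hεR2 : (εR : ℝ) * εR = 1 := by rcases hεR with rfl | rfl <;> norm_num
  have hεy2 : (εy : ℝ) * εy = 1 := by rcases hεy with rfl | rfl <;> norm_num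
  push_cast at hb
  have hb0 : yv w ≠ 0 := by rintro h; rw [h, mul_zero] at hb; exact lt_irrefl _ hb
  have hA' : (A.2 : ℝ) = ρ - A.1 (Fin.last 0) * r := by
    have h := congrArg (fun q : ℚ => (q : ℝ)) hA
    simp only [Rat.cast_add, Rat.cast_mul] at h
    linarith
  -- the positive factor `εy (tᵢ − ρ)/b`
  have hpos : 0 < (εy : ℝ) * (tv w i - ρ) / yv w := by
    have e : ((εR : ℝ) * (tv w i - ρ)) * ((εR : ℝ) * εy * yv w) / (yv w) ^ 2 = (εy : ℝ) * (tv w i - ρ) / yv w := by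
      rw [show ((εR : ℝ) * (tv w i - ρ)) * ((εR : ℝ) * εy * yv w) = ((εR : ℝ) * εR) * (((εy : ℝ) * (tv w i - ρ)) * yv w)
        by ring, hεR2, one_mul, pow_two, mul_div_mul_right _ _ hb0]
    rw [← e]
    exact div_pos (mul_pos hR hb) (lt_of_le_of_ne (sq_nonneg _) (Ne.symm (pow_ne_zero 2 hb0)))
  have key : tv w i - ev A (r + (tv w i - ρ) / yv w) =
      ((εy : ℝ) * yv w + (-(εy * A.1 (Fin.last 0)) : ℚ)) * ((εy : ℝ) * (tv w i - ρ) / yv w) := by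
    have e1 : tv w i - ev A (r + (tv w i - ρ) / yv w) = (yv w - A.1 (Fin.last 0)) * ((tv w i - ρ) / yv w) := by
      rw [ev, hA']; field_simp; ring
    rw [e1, show (yv w - A.1 (Fin.last 0)) * ((tv w i - ρ) / yv w) =
      ((εy : ℝ) * εy) * ((yv w - A.1 (Fin.last 0)) * ((tv w i - ρ) / yv w)) by rw [hεy2, one_mul]]
    push_cast; ring
  rw [cmpLin_iff, ← sub_pos (a := tv w i) (b := ev A _), key, Rat.cast_zero, zero_mul, zero_add]
  exact (mul_pos_iff_of_pos_right hpos).symm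

/-! ### The move -/

/-- For a sign `ε = ±1` and `0 < ε x`: `|x| = ε x`. -/
theorem abs_eq_sign_mul {ε : ℚ} (hε : ε = 1 ∨ ε = -1) {x : ℝ} (hx : 0 < (ε : ℝ) * x) : |x| = ε * x := by
  rcases hε with rfl | rfl
  · push_cast at hx ⊢; rw [one_mul] at hx ⊢; exact abs_of_pos hx
  · push_cast at hx ⊢; rw [neg_one_mul] at hx ⊢; exact abs_of_neg (by linarith)

/-- **The base blow-up of a clean nest with constant top** (rule 2 + rule 1a). Let `s` live on the
clean nest `A < tᵢ < tⱼ < τ` over `cell M` (`τ` constant) with the literal integrand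
`K/((y − r)(tᵢ − cᵢ(y))(tⱼ − κ))` (simple base pole `r = ℓ₂`, `cᵢ` of slope `λ`, `κ` constant,
`ρ = cᵢ(r)` the height of the wall). Assume the nest lies on one side of the pole
(`0 < εy (y − r)`) and of the wall (`0 < εR (tᵢ − ρ)`), inside a cone `|tᵢ − ρ| ≤ C |y − r|`,
and that the bottom `A < tᵢ` is read in the blown-up coordinates `(b, tᵢ, tⱼ)`,
`b = (tᵢ − ρ)/(y − r)`, as the player comparison `qA` (`hqA`). Then `s` is good for `GG 0 2 2`:
under `y = r + (tᵢ − ρ)/b` the integrand becomes the literal `εR K/((b − λ)(tᵢ − ρ)(tⱼ − κ))`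
with constant letters over the bounded order-constrained polytope `blowQ`, whose cells are
good (`good_constraints`). [Kontsevich–Zagier 2001, §1.2, rules (1a), (2)] -/
theorem good_blow (s : KZ.IntegralRep (0 + 1 + 2)) (hij : i ≠ j) (M : Fin m' → Cf) (Ab : Cf) (τ : ℚ)
    (T : BData) (p : MvPolynomial (Fin 0) ℚ) (a : Fin 2 → Option Cf) (ci cj : Cf)
    (hi : a i = some ci) (hj : a j = some cj) (hcj : cj.1 (Fin.last 0) = 0) (h1 : T.n₁ = 0)
    (hn : T.n₂ = 1) (hbd : Bornology.IsBounded s.domain)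
    (hdom : s.domain = gDom 0 2 m' M (nlo i Ab) (nhi j (mk 0 τ)))
    (hint : EqOn s.integrand (glitB T p a) s.domain) (ρ : ℚ)
    (hρ : ρ = ci.2 - (0 - ci.1 (Fin.last 0)) * T.ℓ₂.2) (εR εy : ℚ) (hεR : εR = 1 ∨ εR = -1)
    (hR : ∀ z ∈ s.domain, 0 < (εR : ℝ) * (tv z i - ρ))
    (hy : ∀ z ∈ s.domain, 0 < (εy : ℝ) * (yv z - T.ℓ₂.2)) (C : ℝ)
    (hcone : ∀ z ∈ s.domain, |tv z i - ρ| ≤ C * |yv z - T.ℓ₂.2|)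
    (qA : (Fin 2 ⊕ Cf) × (Fin 2 ⊕ Cf))
    (hqA : ∀ w : Fin (0 + 1 + 2) → ℝ, 0 < ((εR * εy : ℚ) : ℝ) * yv w → 0 < (εR : ℝ) * (tv w i - ρ) →
      (pv qA.1 w < pv qA.2 w ↔ ev Ab (T.ℓ₂.2 + (tv w i - ρ) / yv w) < tv w i)) :
    Good 2 (KZ.of s) := by
  -- notation
  set lam : ℚ := ci.1 (Fin.last 0) with hlamdef
  set r : ℚ := T.ℓ₂.2 with hrdef
  set εb : ℚ := εR * εy with hεbdef
  have hρ' : (ρ : ℝ) = lam * r + ci.2 := by rw [hρ, hlamdef]; push_cast; ring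
  have hci : ∀ y : ℝ, ev ci y = lam * y + ci.2 := fun y => rfl
  have hcjv : ∀ y : ℝ, ev cj y = cj.2 := fun y => by rw [ev, hcj, Rat.cast_zero, zero_mul, zero_add]
  have hτ : ∀ y : ℝ, ev (mk 0 τ) y = τ := fun y => by rw [ev_mk, Rat.cast_zero, zero_mul, zero_add]
  have mD := fun z => mem_nDom hij M Ab (mk 0 τ) z
  have hRne : ∀ z ∈ s.domain, tv z i - ρ ≠ 0 := fun z hz h => by
    have := hR z hz; rw [h, mul_zero] at this; exact lt_irrefl _ this
  have hyne : ∀ z ∈ s.domain, yv z - r ≠ 0 := fun z hz h => by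
    have := hy z hz; rw [h, mul_zero] at this; exact lt_irrefl _ this
  -- a box row
  obtain ⟨Rb, hRb⟩ := hbd.exists_norm_le
  obtain ⟨R₀, hR₀⟩ := exists_rat_gt Rb
  have habs : ∀ z ∈ s.domain, ∀ l, |tv z l| ≤ Rb := fun z hz l =>
    (norm_le_pi_norm z (tIdx l)).trans (hRb z hz)
  have hbox : ∀ z ∈ s.domain, (-R₀ : ℝ) < tv z i := fun z hz => by
    have := (abs_le.1 (habs z hz i)).1; linarith
  -- the polytope and the charts
  set Q := blowQ i j M qA τ ρ r R₀ εR εb with hQ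
  have mQ := fun w => mem_blowQ (i := i) (j := j) M qA τ ρ r R₀ εR εb w
  set Ψ := blowΨ i ρ r with hΨ
  set Φ := blowΦ i ρ r with hΦ
  -- `Φ` maps the domain into the polytope
  have hDR : ∀ z ∈ s.domain, Φ z ∈ Q := fun z hz => by
    obtain ⟨hcell, hA, h2, h3⟩ := (mD z).1 (hdom ▸ hz)
    rw [hτ] at h3
    have hX := hRne z hz
    have hY := hyne z hz
    have hRz := hR z hz
    have hyz := hy z hz
    have eb : yv (Φ z) = (tv z i - ρ) / (yv z - r) := yv_blowΦ ρ r z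
    have ei : tv (Φ z) i = tv z i := tv_blowΦ ρ r z i
    have ej : tv (Φ z) j = tv z j := tv_blowΦ ρ r z j
    have hb : 0 < (εb : ℝ) * yv (Φ z) := by
      rw [eb, hεbdef]
      have e : ((εR * εy : ℚ) : ℝ) * ((tv z i - ρ) / (yv z - r)) =
          ((εR : ℝ) * (tv z i - ρ)) * ((εy : ℝ) * (yv z - r)) / (yv z - r) ^ 2 := by
        push_cast; field_simp
      rw [e]
      positivity
    have hback : (r : ℝ) + (tv (Φ z) i - ρ) / yv (Φ z) = yv z := by
      rw [ei, eb]; field_simp; ring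
    rw [mQ, ei, ej]
    refine ⟨h2, h3, hbox z hz, hRz, hb, ?_, fun k => ?_⟩
    · rw [hqA (Φ z) hb (by rw [ei]; exact hRz), hback, ei]; exact hA
    · have hk := hcell k
      rw [ev] at hk
      have e : (εb : ℝ) * ((((M k).1 (Fin.last 0) : ℝ) * r + (M k).2) * yv (Φ z) +
          (M k).1 (Fin.last 0) * (tv z i - ρ)) =
          ((εb : ℝ) * yv (Φ z)) * (((M k).1 (Fin.last 0) : ℝ) * yv z + (M k).2) := by
        rw [eb]; field_simp; ring
      rw [e]
      exact mul_pos hb hk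
  -- `Ψ` maps the polytope into the domain
  have hRD : ∀ w ∈ Q, Ψ w ∈ s.domain := fun w hw => by
    obtain ⟨h1', h2', -, h4', h5', h6', h7'⟩ := (mQ w).1 hw
    have hb0 : yv w ≠ 0 := by rintro h; rw [h, mul_zero] at h5'; exact lt_irrefl _ h5'
    have ey : yv (Ψ w) = r + (tv w i - ρ) / yv w := yv_blowΨ ρ r w
    have ei : tv (Ψ w) i = tv w i := tv_blowΨ ρ r w i
    have ej : tv (Ψ w) j = tv w j := tv_blowΨ ρ r w j
    rw [hdom, mD, ey, ei, ej, hτ]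
    refine ⟨fun k => ?_, ?_, h1', h2'⟩
    · have hk := h7' k
      have e : (εb : ℝ) * ((((M k).1 (Fin.last 0) : ℝ) * r + (M k).2) * yv w +
          (M k).1 (Fin.last 0) * (tv w i - ρ)) =
          ((εb : ℝ) * yv w) * ev (M k) (r + (tv w i - ρ) / yv w) := by
        rw [ev]; field_simp; ring
      rw [e] at hk
      exact pos_of_mul_pos_right hk h5'.le
    · exact (hqA w h5' h4').1 h6'
  have himg : Ψ '' Q = s.domain := by
    ext z
    constructor
    · rintro ⟨w, hw, rfl⟩
      exact hRD w hw
    · intro hz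
      exact ⟨Φ z, hDR z hz, blowΨ_blowΦ ρ r (sub_ne_zero.1 (hyne z hz)) (sub_ne_zero.1 (hRne z hz))⟩
  have hRQ : ∀ w ∈ Q, tv w i ≠ ρ := fun w hw h => by
    have h4' := ((mQ w).1 hw).2.2.2.1
    rw [h, sub_self, mul_zero] at h4'
    exact lt_irrefl _ h4'
  have hbQ : ∀ w ∈ Q, yv w ≠ 0 := fun w hw h => by
    have h5' := ((mQ w).1 hw).2.2.2.2.1
    rw [h, mul_zero] at h5'
    exact lt_irrefl _ h5'
  have hsaQ : IsSemialgebraic ℚ Q := isSemialgebraic_cmpSet _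
  -- the new literal datum
  set T' : BData := ⟨T.m, T.L, T.e, T.ℓ₁, (0, lam), 0, 1⟩ with hT'
  set a' : Fin 2 → Option Cf := Function.update a i (some (mk 0 ρ)) with ha'
  have ha'i : a' i = some (mk 0 ρ) := by rw [ha', Function.update_self]
  have ha'j : a' j = some cj := by rw [ha', Function.update_of_ne hij.symm, hj]
  set f' : (Fin (0 + 1 + 2) → ℝ) → ℝ := glitB T' (MvPolynomial.C εR * p) a' with hf'
  have hf : ∀ w ∈ Q, f' w = s.integrand (Ψ w) * |(blowΨL i ρ w).det| := by
    intro w hw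
    have hzD := hRD w hw
    obtain ⟨-, -, -, h4', h5', -, -⟩ := (mQ w).1 hw
    have hb0 : yv w ≠ 0 := hbQ w hw
    have hX : tv w i - ρ ≠ 0 := sub_ne_zero.2 (hRQ w hw)
    have ey : yv (Ψ w) = r + (tv w i - ρ) / yv w := yv_blowΨ ρ r w
    have ei : tv (Ψ w) i = tv w i := tv_blowΨ ρ r w i
    have ej : tv (Ψ w) j = tv w j := tv_blowΨ ρ r w j
    have habsX : |tv w i - ρ| = εR * (tv w i - ρ) := abs_eq_sign_mul hεR h4'
    have hεR2 : (εR : ℝ) * εR = 1 := by rcases hεR with rfl | rfl <;> norm_num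
    have hK : Kc T' p = Kc T p := rfl
    have hT'ℓ : T'.ℓ₂.2 = lam := rfl
    have eL : f' w = εR * (Kc T p * (1 / (yv w - lam)) * ((1 / (tv w i - ρ)) * (1 / (tv w j - cj.2)))) := by
      rw [hf', glit_C_mul, glitB_two T' p a' hij (mk 0 ρ) cj ha'i ha'j rfl rfl, ev_mk, hcjv, hK, hT'ℓ]
      simp only [Rat.cast_zero, zero_mul, zero_add]
    have eci : tv w i - ev ci (r + (tv w i - ρ) / yv w) = (tv w i - ρ) * (yv w - lam) / yv w := by
      rw [hci, hρ']
      field_simp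
      ring
    have eR : s.integrand (Ψ w) * |(blowΨL i ρ w).det| =
        Kc T p * (1 / ((tv w i - ρ) / yv w)) * ((1 / ((tv w i - ρ) * (yv w - lam) / yv w)) *
          (1 / (tv w j - cj.2))) * ((εR : ℝ) * (tv w i - ρ) / (yv w) ^ 2) := by
      rw [hint hzD, abs_det_blowΨL, glitB_two T p a hij ci cj hi hj h1 hn, ← hrdef, ey, ei, ej, hcjv,
        add_sub_cancel_left, eci, habsX]
    rw [eL, eR]
    by_cases hl : yv w - (lam : ℝ) = 0
    · rw [hl]; simp
    by_cases hv : tv w j - (cj.2 : ℝ) = 0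
    · rw [hv]; simp
    field_simp
  -- rule (2)
  obtain ⟨r', hd', hi', hrel⟩ := cov_pull s hsaQ Ψ (fun w => blowΨL i ρ w)
    (isSemialgebraicMapOn_blowΨ ρ r hsaQ hbQ)
    (fun w hw => (hasFDerivAt_blowΨ ρ r w (hbQ w hw)).hasFDerivWithinAt)
    (blowΨ_injOn ρ r hRQ) himg f' (isSemialgebraicFunOn_glit hsaQ _ _ _ _ _ _ _ _) hf
  -- the blown-up polytope is bounded
  have hbdQ : Bornology.IsBounded Q := by
    refine IntegrateOutLow.isBounded_of_forall_abs_le (max Rb C) fun w hw l => ?_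
    have hzD := hRD w hw
    rcases idx_cases l with rfl | ⟨l, rfl⟩
    · -- the new base is bounded by the cone
      have hX : 0 < |tv w i - ρ| := abs_pos.2 (sub_ne_zero.2 (hRQ w hw))
      have hc := hcone _ hzD
      rw [tv_blowΨ, yv_blowΨ, add_sub_cancel_left, abs_div] at hc
      have hb0 : 0 < |yv w| := abs_pos.2 (hbQ w hw)
      rw [mul_div_assoc', le_div_iff₀ hb0] at hc
      have : |yv w| ≤ C := le_of_mul_le_mul_left (by linarith) hX
      exact this.trans (le_max_right _ _)
    · have h := habs _ hzD l
      rw [tv_blowΨ] at h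
      exact h.trans (le_max_left _ _)
  rw [← hd'] at hbdQ
  -- the cells
  refine RebaseZero.good_of_sub_mem hrel (good_constraints r' (blowC i j M qA τ ρ r R₀ εR εb) T.L T.e
    (MvPolynomial.C εR * p) T.ℓ₁ (0, lam) a' rfl rfl ⟨0, fun l c hc => ?_⟩ hbdQ (blowC_hlu hij M qA τ ρ r R₀ εR εb)
    hd' (fun w _ => by rw [hi', hf']; rfl))
  rcases fin_two_eq_or hij l with rfl | rfl
  · rw [ha'i] at hc; cases hc; rfl
  · rw [ha'j] at hc; cases hc; exact hcj

end RebaseDiff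

/-- **Registered brick `rebaseSimpleZero_e2Blow` of the part `HPar1` (stub `stub_rebaseSimpleZeroTwo`,
line `janus-bands`): the base blow-up.** A clean nest `A < tᵢ < tⱼ < τ` (`τ` constant) with the
literal integrand `K/((y − r)(tᵢ − cᵢ(y))(tⱼ − κ))` (simple base pole `r = ℓ₂.2`, outer letter
constant), lying on one side of the pole and of the wall `tᵢ = ρ = cᵢ(r)`, in a cone
`|tᵢ − ρ| ≤ C |y − r|`, whose bottom is read in the blown-up coordinates `b = (tᵢ − ρ)/(y − r)` as
a player comparison, is congruent modulo `KZ.relations` to the subgroup generated by `GG 0 2 2`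
(`RebaseDiff.good_blow`: the chart `y = r + (tᵢ − ρ)/b` makes all letters constant, the image is a
bounded order-constrained polytope, its cells are good). [Kontsevich–Zagier 2001, §1.2] -/
theorem rebaseSimpleZero_e2Blow (m' : ℕ) (i j : Fin 2) (s : KZ.IntegralRep (0 + 1 + 2)) (hij : i ≠ j) (M : Fin m' → (Fin (0 + 1) → ℚ) × ℚ) (Ab : (Fin (0 + 1) → ℚ) × ℚ) (τ : ℚ) (T : RebaseZero.BData) (p : MvPolynomial (Fin 0) ℚ) (a : Fin 2 → Option ((Fin (0 + 1) → ℚ) × ℚ)) (ci cj : (Fin (0 + 1) → ℚ) × ℚ) (hi : a i = some ci) (hj : a j = some cj) (hcj : cj.1 (Fin.last 0) = 0) (h1 : T.n₁ = 0) (hn : T.n₂ = 1) (hbd : Bornology.IsBounded s.domain) (hdom : s.domain = SeparatePos.gDom 0 2 m' M (RebaseNest.nlo i Ab) (RebaseNest.nhi j (RebaseZero.mk 0 τ))) (hint : EqOn s.integrand (RebaseZero.glitB T p a) s.domain) (ρ : ℚ) (hρ : ρ = ci.2 - (0 - ci.1 (Fin.last 0)) * T.ℓ₂.2) (εR εy :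 ℚ) (hεR : εR = 1 ∨ εR = -1) (hR : ∀ z ∈ s.domain, 0 < (εR : ℝ) * (RebaseZero.tv z i - ρ)) (hy : ∀ z ∈ s.domain, 0 < (εy : ℝ) * (RebaseZero.yv z - T.ℓ₂.2)) (C : ℝ) (hcone : ∀ z ∈ s.domain, |RebaseZero.tv z i - ρ| ≤ C * |RebaseZero.yv z - T.ℓ₂.2|) (qA : (Fin 2 ⊕ ((Fin (0 + 1) → ℚ) × ℚ)) × (Fin 2 ⊕ ((Fin (0 + 1) → ℚ) × ℚ))) (hqA : ∀ w : Fin (0 + 1 + 2) → ℝ, 0 < ((εR * εy : ℚ) : ℝ) * RebaseZero.yv w → 0 < (εR : ℝ) * (RebaseZero.tv w i - ρ) → (RebasePos.pv qA.1 w < RebasePos.pv qA.2 w ↔ RebaseZero.ev Ab (T.ℓ₂.2 + (RebaseZero.tv w i - ρ) / RebaseZero.yv w) < RebaseZero.tv w i)) : ∃ c ∈ AddSubgroup.closure (SeparatePos.GGset 0 2 2), KZ.of s - c ∈ KZ.relations :=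
  RebaseDiff.good_blow s hij M Ab τ T p a ci cj hi hj hcj h1 hn hbd hdom hint ρ hρ εR εy hεR hR hy C hcone qA hqA

end Summit.KontsevichZagierPeriods.ArrangementNormalForm.JanusBands
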